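import Summits.KontsevichZagierPeriods.Zeta5Search.Certificates.RayH1Forms
import Summits.KontsevichZagierPeriods.Zeta5Search.Certificates.BinomialSumBounds
import Summits.KontsevichZagierPeriods.Zeta5Search.Certificates.LogEnclosures
import Summits.KontsevichZagierPeriods.Zeta5Search.Certificates.LogEnclosuresRayC1
import Summits.KontsevichZagierPeriods.Zeta5Search.Certificates.LogEnclosuresRayC1B
import Summits.KontsevichZagierPeriods.Zeta5Search.Certificates.LogEnclosuresRayC1B2
import Summits.KontsevichZagierPeriods.Zeta5Search.Certificates.LogEnclosuresRayC1C
import Summits.KontsevichZagierPeriods.Zeta5Search.Certificates.LogEnclosuresRayC1D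
import Summits.KontsevichZagierPeriods.Zeta5Search.Certificates.LogEnclosuresRayC5
import Summits.KontsevichZagierPeriods.Zeta5Search.Certificates.LogEnclosuresRayC5B
import Summits.KontsevichZagierPeriods.Zeta5Search.Certificates.LogEnclosuresRayC5B2
import Summits.KontsevichZagierPeriods.Zeta5Search.Certificates.LogEnclosuresRayC5C
import Summits.KontsevichZagierPeriods.Zeta5Search.Certificates.LogEnclosuresRayH1
import Summits.KontsevichZagierPeriods.Zeta5Search.Certificates.LogEnclosuresRecord
import Summits.KontsevichZagierPeriods.Zeta5Search.Certificates.LogEnclosuresRecord2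
import Summits.KontsevichZagierPeriods.Zeta5Search.Certificates.LogEnclosuresRecord3
import Summits.KontsevichZagierPeriods.Zeta5Search.Certificates.LogEnclosuresRecord3B
import Summits.KontsevichZagierPeriods.Zeta5Search.Certificates.LogEnclosuresRecord3C
import Summits.KontsevichZagierPeriods.Zeta5Search.Certificates.LogEnclosuresRecord4
import Summits.KontsevichZagierPeriods.Zeta5Search.Certificates.LogEnclosuresSect12
import Summits.KontsevichZagierPeriods.Zeta5Search.Certificates.LogEnclosuresSect12B
import Summits.KontsevichZagierPeriods.Zeta5Search.Certificates.RecordRayGrowthUpper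
import HarnessLib

/-!
# ζ(5) search — certificates: the growth of `Q(a·n)` on the ray RayH1, PROVED without a recurrence — I: lower bound
(cell `pub-zeta5`, P1 g11; port of certifier 2's `Certificates/RecordRayGrowth.lean`)

HONEST FRAMING: systematic search; no irrationality claim unless certified.

OUR work (Summit side). For the census T1-map ray `a·n`, `a = (7,13,9,12,11,15,17,12)` (`RayH1Forms`), the growth of
`Q(a·n) = h1Q n` is bounded here from BELOW by tree theorems only (Stirling at a lattice point; certified logarithms):

* `abs_h1Q_ge` — for every `n ≥ 1`: `log|Q(a·n)| ≥ n·E − (7/2)·log(27n) − 14`, `E = growthEnt` = the entropy of the single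
  lattice term `(k₁,k₂) = (22n, 21n)` of (17); `growthEnt_ge` : `E ≥ 72.9015` (true value `72.901575`; the real maximiser
  of the entropy is at `(k₁,k₂)/n ≈` the model point with value `72.9344` — the integer point costs `0.0328` nats).
The upper bound and the rates are in `Certificates/RayH1GrowthUpper.lean`. Method: CERTIFY-HOWTO §9 (certifier 2).
-/

noncomputable section

open Finset Real Filter

namespace Summit.KontsevichZagierPeriods.Zeta5Search.RayH1

open Summit.KontsevichZagierPeriods.Zeta5Search.BinomialSum
open Summit.KontsevichZagierPeriods.Zeta5Search.LogEnclosures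
open Literature.NumberTheory.Irrationality.BrownZudilin2022 (zchoose Qcoeff QOf pOf qOf)

/-! ### (17) on the ray -/

/-- The scaled parameter vector `p(a·n)`. -/
def pRayH1 (n : ℕ) : Fin 7 → ℤ := ![14 * n, 13 * n, 15 * n, 25 * n, 17 * n, 12 * n, 11 * n]

/-- The scaled parameter vector `q(a·n)`. -/
def qRayH1 (n : ℕ) : Fin 5 → ℤ := ![12 * n, 11 * n, 9 * n, 7 * n, 13 * n]

/-- `p(a·n) = pRayH1 n`. -/
theorem pOf_aH1 (n : ℕ) : pOf (aH1 n) = pRayH1 n := by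
  ext i; fin_cases i <;> simp [pOf, aH1, h1Vec, pRayH1] <;> ring

/-- `q(a·n) = qRayH1 n`. -/
theorem qOf_aH1 (n : ℕ) : qOf (aH1 n) = qRayH1 n := by
  ext i; fin_cases i <;> simp [qOf, aH1, h1Vec, qRayH1] <;> ring

/-- `Q(a·n) = Q(pRayH1 n; qRayH1 n)`. -/
theorem h1Q_eq_Qcoeff (n : ℕ) : h1Q n = Qcoeff (pRayH1 n) (qRayH1 n) := by
  unfold h1Q QOf; rw [pOf_aH1, qOf_aH1]

/-- `p(a·n)_0 = 14n`. -/
@[simp] theorem pRayH1_0 (n : ℕ) : pRayH1 n 0 = 14 * n := rfl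
/-- `p(a·n)_1 = 13n`. -/
@[simp] theorem pRayH1_1 (n : ℕ) : pRayH1 n 1 = 13 * n := rfl
/-- `p(a·n)_2 = 15n`. -/
@[simp] theorem pRayH1_2 (n : ℕ) : pRayH1 n 2 = 15 * n := rfl
/-- `p(a·n)_3 = 25n`. -/
@[simp] theorem pRayH1_3 (n : ℕ) : pRayH1 n 3 = 25 * n := rfl
/-- `p(a·n)_4 = 17n`. -/
@[simp] theorem pRayH1_4 (n : ℕ) : pRayH1 n 4 = 17 * n := rfl
/-- `p(a·n)_5 = 12n`. -/
@[simp] theorem pRayH1_5 (n : ℕ) : pRayH1 n 5 = 12 * n := rfl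
/-- `p(a·n)_6 = 11n`. -/
@[simp] theorem pRayH1_6 (n : ℕ) : pRayH1 n 6 = 11 * n := rfl
/-- `q(a·n)_0 = 12n`. -/
@[simp] theorem qRayH1_0 (n : ℕ) : qRayH1 n 0 = 12 * n := rfl
/-- `q(a·n)_1 = 11n`. -/
@[simp] theorem qRayH1_1 (n : ℕ) : qRayH1 n 1 = 11 * n := rfl
/-- `q(a·n)_2 = 9n`. -/
@[simp] theorem qRayH1_2 (n : ℕ) : qRayH1 n 2 = 9 * n := rfl
/-- `q(a·n)_3 = 7n`. -/
@[simp] theorem qRayH1_3 (n : ℕ) : qRayH1 n 3 = 7 * n := rfl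
/-- `q(a·n)_4 = 13n`. -/
@[simp] theorem qRayH1_4 (n : ℕ) : qRayH1 n 4 = 13 * n := rfl

/-! ### Lower bound: the lattice term `(22n, 21n)` -/

/-- The `(22n,21n)`-term of (17) on the ray as a product of seven natural binomials. -/
theorem latticeTerm_eq (n : ℕ) :
    qTerm (pRayH1 n) (qRayH1 n) (22 * n) (21 * n) =
      ((22 * n).choose (14 * n) : ℤ) * ((21 * n).choose (11 * n) : ℤ) * ((27 * n).choose (9 * n) : ℤ) * ((12 * n).choose (9 * n) : ℤ) * ((11 * n).choose (7 * n) : ℤ) * ((7 * n).choose (4 * n) : ℤ) * ((13 * n).choose (9 * n) : ℤ) := by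
  unfold qTerm
  simp only [pRayH1_0, pRayH1_1, pRayH1_2, pRayH1_3, pRayH1_4, pRayH1_5, pRayH1_6, qRayH1_0, qRayH1_1, qRayH1_2, qRayH1_3, qRayH1_4]
  rw [zchoose_cast_eq (n := 22 * n) (k := 14 * n) (by push_cast; ring) (by push_cast; ring) (by omega),
    zchoose_cast_eq (n := 21 * n) (k := 11 * n) (by push_cast; ring) (by push_cast; ring) (by omega),
    zchoose_cast_eq (n := 27 * n) (k := 9 * n) (by push_cast; ring) (by push_cast; ring) (by omega),
    zchoose_cast_eq (n := 12 * n) (k := 9 * n) (by push_cast; ring) (by push_cast; ring) (by omega),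
    zchoose_cast_eq (n := 11 * n) (k := 7 * n) (by push_cast; ring) (by push_cast; ring) (by omega),
    zchoose_cast_eq (n := 7 * n) (k := 4 * n) (by push_cast; ring) (by push_cast; ring) (by omega),
    zchoose_cast_eq (n := 13 * n) (k := 9 * n) (by push_cast; ring) (by push_cast; ring) (by omega)]

/-- The entropy of the lattice term per step `n` (`= 72.90157482…`). -/
def growthEnt : ℝ :=
  (22 * Real.log 22 - 14 * Real.log 14 - (22 - 14) * Real.log (22 - 14))
  + (21 * Real.log 21 - 11 * Real.log 11 - (21 - 11) * Real.log (21 - 11))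
  + (27 * Real.log 27 - 9 * Real.log 9 - (27 - 9) * Real.log (27 - 9))
  + (12 * Real.log 12 - 9 * Real.log 9 - (12 - 9) * Real.log (12 - 9))
  + (11 * Real.log 11 - 7 * Real.log 7 - (11 - 7) * Real.log (11 - 7))
  + (7 * Real.log 7 - 4 * Real.log 4 - (7 - 4) * Real.log (7 - 4))
  + (13 * Real.log 13 - 9 * Real.log 9 - (13 - 9) * Real.log (13 - 9))

/-- **`E ≥ 72.9015`** (certified logarithms). -/
theorem growthEnt_ge : (145803 / 2000 : ℝ) ≤ growthEnt := by
  unfold growthEnt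
  norm_num only
  obtain ⟨lo0, hi0⟩ := log_22_bounds
  obtain ⟨lo1, hi1⟩ := log_14_bounds
  obtain ⟨lo2, hi2⟩ := log_8_bounds
  obtain ⟨lo3, hi3⟩ := log_21_bounds
  obtain ⟨lo4, hi4⟩ := log_11_bounds
  obtain ⟨lo5, hi5⟩ := log_10_bounds
  obtain ⟨lo6, hi6⟩ := log_27_bounds
  obtain ⟨lo7, hi7⟩ := log_9_bounds
  obtain ⟨lo8, hi8⟩ := log_18_bounds
  obtain ⟨lo9, hi9⟩ := log_12_bounds
  obtain ⟨lo10, hi10⟩ := log_three_bounds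
  obtain ⟨lo11, hi11⟩ := log_7_bounds
  obtain ⟨lo12, hi12⟩ := log_4_bounds
  obtain ⟨lo13, hi13⟩ := log_13_bounds
  linarith

/-- The lattice term is positive. -/
theorem latticeTerm_pos (n : ℕ) : (0 : ℝ) < (qTerm (pRayH1 n) (qRayH1 n) (22 * n) (21 * n) : ℝ) := by
  rw [latticeTerm_eq]; push_cast
  have c1 : (0 : ℝ) < ((22 * n).choose (14 * n) : ℝ) := by exact_mod_cast Nat.choose_pos (by omega)
  have c2 : (0 : ℝ) < ((21 * n).choose (11 * n) : ℝ) := by exact_mod_cast Nat.choose_pos (by omega)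
  have c3 : (0 : ℝ) < ((27 * n).choose (9 * n) : ℝ) := by exact_mod_cast Nat.choose_pos (by omega)
  have c4 : (0 : ℝ) < ((12 * n).choose (9 * n) : ℝ) := by exact_mod_cast Nat.choose_pos (by omega)
  have c5 : (0 : ℝ) < ((11 * n).choose (7 * n) : ℝ) := by exact_mod_cast Nat.choose_pos (by omega)
  have c6 : (0 : ℝ) < ((7 * n).choose (4 * n) : ℝ) := by exact_mod_cast Nat.choose_pos (by omega)
  have c7 : (0 : ℝ) < ((13 * n).choose (9 * n) : ℝ) := by exact_mod_cast Nat.choose_pos (by omega)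
  exact mul_pos (mul_pos (mul_pos (mul_pos (mul_pos (mul_pos c1 c2) c3) c4) c5) c6) c7

/-- The lattice point lies in the box of (17). -/
theorem lattice_mem (n : ℕ) : (22 * n : ℤ) ∈ Icc (pRayH1 n 1) (pRayH1 n 1 + qRayH1 n 0) ∧
    (21 * n : ℤ) ∈ Icc (pRayH1 n 4) (pRayH1 n 4 + qRayH1 n 3) := by
  rw [mem_Icc, mem_Icc, pRayH1_1, qRayH1_0, pRayH1_4, qRayH1_3]
  refine ⟨⟨by linarith, by linarith⟩, ⟨by linarith, by linarith⟩⟩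

/-- The lattice term bounds `|Q(a·n)|` from below, and hence `|Q(a·n)| > 0`, for every `n`. -/
theorem latticeTerm_le_abs_h1Q (n : ℕ) :
    (qTerm (pRayH1 n) (qRayH1 n) (22 * n) (21 * n) : ℝ) ≤ |(h1Q n : ℝ)| ∧ (0 : ℝ) < |(h1Q n : ℝ)| := by
  obtain ⟨hk₁, hk₂⟩ := lattice_mem n
  have hle := qTerm_le_abs_Qcoeff (pRayH1 n) (qRayH1 n) hk₁ hk₂
  rw [← h1Q_eq_Qcoeff] at hle
  exact ⟨hle, (latticeTerm_pos n).trans_le hle⟩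

/-- The sum of the seven Stirling lower bounds at the lattice point, per factor. -/
def latticeStirling (n : ℕ) : ℝ :=
  ((n : ℝ) * (22 * Real.log 22 - 14 * Real.log 14 - (22 - 14) * Real.log (22 - 14)) - Real.log (22 * n) / 2 - 2)
  + ((n : ℝ) * (21 * Real.log 21 - 11 * Real.log 11 - (21 - 11) * Real.log (21 - 11)) - Real.log (21 * n) / 2 - 2)
  + ((n : ℝ) * (27 * Real.log 27 - 9 * Real.log 9 - (27 - 9) * Real.log (27 - 9)) - Real.log (27 * n) / 2 - 2)
  + ((n : ℝ) * (12 * Real.log 12 - 9 * Real.log 9 - (12 - 9) * Real.log (12 - 9)) - Real.log (12 * n) / 2 - 2)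
  + ((n : ℝ) * (11 * Real.log 11 - 7 * Real.log 7 - (11 - 7) * Real.log (11 - 7)) - Real.log (11 * n) / 2 - 2)
  + ((n : ℝ) * (7 * Real.log 7 - 4 * Real.log 4 - (7 - 4) * Real.log (7 - 4)) - Real.log (7 * n) / 2 - 2)
  + ((n : ℝ) * (13 * Real.log 13 - 9 * Real.log 9 - (13 - 9) * Real.log (13 - 9)) - Real.log (13 * n) / 2 - 2)

/-- Replacing every `log(αᵢ n)` by `log(27 n)`: `n·E − (7/2)·log(27n) − 14 ≤ latticeStirling n`. -/
theorem latticeStirling_ge {n : ℕ} (hn : 1 ≤ n) :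
    (n : ℝ) * growthEnt - 7 / 2 * Real.log (27 * n) - 14 ≤ latticeStirling n := by
  have hn' : (1 : ℝ) ≤ n := by exact_mod_cast hn
  have m1 : Real.log (22 * n) ≤ Real.log (27 * n) := Real.log_le_log (by positivity) (by linarith)
  have m2 : Real.log (21 * n) ≤ Real.log (27 * n) := Real.log_le_log (by positivity) (by linarith)
  have m4 : Real.log (12 * n) ≤ Real.log (27 * n) := Real.log_le_log (by positivity) (by linarith)
  have m5 : Real.log (11 * n) ≤ Real.log (27 * n) := Real.log_le_log (by positivity) (by linarith)
  have m6 : Real.log (7 * n) ≤ Real.log (27 * n) := Real.log_le_log (by positivity) (by linarith)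
  have m7 : Real.log (13 * n) ≤ Real.log (27 * n) := Real.log_le_log (by positivity) (by linarith)
  have hE : latticeStirling n = (n : ℝ) * growthEnt - (Real.log (22 * n) + Real.log (21 * n) + Real.log (27 * n) + Real.log (12 * n) + Real.log (11 * n) + Real.log (7 * n) + Real.log (13 * n)) / 2 - 14 := by
    unfold latticeStirling growthEnt; ring
  rw [hE]
  linarith

/-- Stirling for the seven factors: `exp(latticeStirling n) ≤` the lattice term. -/
theorem exp_le_latticeTerm {n : ℕ} (hn : 1 ≤ n) :
    Real.exp (latticeStirling n) ≤ (qTerm (pRayH1 n) (qRayH1 n) (22 * n) (21 * n) : ℝ) := by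
  rw [latticeTerm_eq]; push_cast
  have s1 := log_choose_ge_scaled (α := 22) (β := 14) (by norm_num) (by norm_num) hn
  have s2 := log_choose_ge_scaled (α := 21) (β := 11) (by norm_num) (by norm_num) hn
  have s3 := log_choose_ge_scaled (α := 27) (β := 9) (by norm_num) (by norm_num) hn
  have s4 := log_choose_ge_scaled (α := 12) (β := 9) (by norm_num) (by norm_num) hn
  have s5 := log_choose_ge_scaled (α := 11) (β := 7) (by norm_num) (by norm_num) hn
  have s6 := log_choose_ge_scaled (α := 7) (β := 4) (by norm_num) (by norm_num) hn
  have s7 := log_choose_ge_scaled (α := 13) (β := 9) (by norm_num) (by norm_num) hn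
  push_cast at s1 s2 s3 s4 s5 s6 s7
  have c1 : (0 : ℝ) < ((22 * n).choose (14 * n) : ℝ) := by exact_mod_cast Nat.choose_pos (by omega)
  have c2 : (0 : ℝ) < ((21 * n).choose (11 * n) : ℝ) := by exact_mod_cast Nat.choose_pos (by omega)
  have c3 : (0 : ℝ) < ((27 * n).choose (9 * n) : ℝ) := by exact_mod_cast Nat.choose_pos (by omega)
  have c4 : (0 : ℝ) < ((12 * n).choose (9 * n) : ℝ) := by exact_mod_cast Nat.choose_pos (by omega)
  have c5 : (0 : ℝ) < ((11 * n).choose (7 * n) : ℝ) := by exact_mod_cast Nat.choose_pos (by omega)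
  have c6 : (0 : ℝ) < ((7 * n).choose (4 * n) : ℝ) := by exact_mod_cast Nat.choose_pos (by omega)
  have c7 : (0 : ℝ) < ((13 * n).choose (9 * n) : ℝ) := by exact_mod_cast Nat.choose_pos (by omega)
  have hprod := prod7_le (Real.exp_nonneg _) (Real.exp_nonneg _) (Real.exp_nonneg _) (Real.exp_nonneg _)
    (Real.exp_nonneg _) (Real.exp_nonneg _) (Real.exp_nonneg _)
    ((Real.le_log_iff_exp_le c1).1 s1) ((Real.le_log_iff_exp_le c2).1 s2) ((Real.le_log_iff_exp_le c3).1 s3)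
    ((Real.le_log_iff_exp_le c4).1 s4) ((Real.le_log_iff_exp_le c5).1 s5) ((Real.le_log_iff_exp_le c6).1 s6)
    ((Real.le_log_iff_exp_le c7).1 s7)
  refine le_trans (le_of_eq ?_) hprod
  simp only [← Real.exp_add]
  rfl

/-- **Lower bound for every `n ≥ 1`**: `n·E − (7/2)·log(27n) − 14 ≤ log|Q(a·n)|`. -/
theorem abs_h1Q_ge {n : ℕ} (hn : 1 ≤ n) :
    (n : ℝ) * growthEnt - 7 / 2 * Real.log (27 * n) - 14 ≤ Real.log |(h1Q n : ℝ)| := by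
  obtain ⟨hk₁, hk₂⟩ := lattice_mem n
  have hle := qTerm_le_abs_Qcoeff (pRayH1 n) (qRayH1 n) hk₁ hk₂
  rw [← h1Q_eq_Qcoeff] at hle
  have h := (Real.le_log_iff_exp_le (latticeTerm_le_abs_h1Q n).2).2 ((exp_le_latticeTerm hn).trans hle)
  exact (latticeStirling_ge hn).trans h

end Summit.KontsevichZagierPeriods.Zeta5Search.RayH1
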